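import Literature.NumberTheory.EllipticCurves.TateModuleCharpolyOfDegree
import HarnessLib

/-!
# `deg = det` on the Tate module: the kernel count is only needed for *étale-type* test polynomials

Sibling proof file (theorems only) of `TateModuleCharpolyOfDegree`.  There, Milne's Prop. 12.9
(= Mumford §19 Thm. 4: the characteristic polynomial of `T_p(φ)` is the polynomial `P` attached to a
multiplicative polynomial degree function `δ` on `ℤ[X] → End A`, `F ↦ F(φ)`) asks for the kernel count

  `#{a ∈ A[p^∞] | F(φ) a = 0} = p^{v_p(δ F)}`   for EVERY monic `F ∈ ℤ[X]` with `δ F ≠ 0`   (`hker`).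

In the geometric situation (`A = J(k̄)`, `φ` a Frobenius `π`, `δ = deg`) this count is elementary only
when `F(π)` is an *étale* (separable) isogeny — `deg = #Ker` — which happens exactly when the
characteristic `ℓ` of the ground field does not divide `F(0)` (`d F(π) = F(0)`; Milne 1986, §19, proof
of Thm. 19.1; in the tree `AbelianVariety.natCard_kerPoints_aeval_frobeniusHom`,
`Motives/AbelianVarietyFrobeniusKernel`); for inseparable `F(π)` the printed proofs invoke the
`p`-power order of connected finite group schemes.  This file removes that input: it suffices to know
the count for monic `F` in any class `S` which is reached from every monic `F` by shifts
`F + c p^M` of the constant term by ARBITRARILY `p`-DIVISIBLE integers (`hS`; e.g. `S F ⇔ ℓ ∤ F(0)` for a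
prime `ℓ ≠ p`: one of `F(0) + p^M`, `F(0) + 2 p^M` is prime to `ℓ`, `shift_coeff_zero_not_dvd`).

* `TateModule.padicValInt_delta_shift_eq` — **`δ` is `p`-adically continuous** (from `hpoly`, after
  clearing the denominators of the polynomial `H_e`): for monic `F` of positive degree with `δ F ≠ 0`
  and `M > M₀(F)`, `δ(F + c p^M) ≠ 0` and `v_p(δ(F + c p^M)) = v_p(δ F)` for all `c ∈ ℤ`;
* `TateModule.forall_ker_of_shift` — **the kernel count for all monic `F` with `δ F ≠ 0` follows from
  the count on `S`**: on `A[p^M]` the endomorphisms `F(φ)` and `(F + c p^M)(φ)` agree, the kernel of the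
  latter has order `p^v`, `v = v_p(δ F)`, hence is killed by `p^v` (Lagrange), so for `M ≥ v` both
  `p`-primary kernels lie in `A[p^M]` and coincide;
* `TateModule.charpoly_map_eq_of_degreeFunction_of_shift`,
  `TateModule.det_one_sub_map_pow_eq_of_degreeFunction_of_shift`,
  `RationalTateModule.det_one_sub_pow_eq_of_degreeFunction_of_shift` — the conclusions of
  `TateModuleCharpolyOfDegree` under the weakened hypothesis.

No named facts, no definitions.

## References

* [Milne1986AbelianVarieties] J. S. Milne, *Abelian varieties*, in Cornell–Silverman (eds.),
  *Arithmetic Geometry* (1986), §12 Prop. 12.9 and its proof; §19, proof of Thm. 19.1 (p. 145: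
  "`1 - π_A^m` is étale, and the order `N_m` of its kernel in `A(k̄)` is equal to its degree").
* [MumfordAV1970] D. Mumford, *Abelian Varieties* (1970), §19, Thm. 4.
-/

noncomputable section

open scoped Classical AddSubgroup
open Polynomial

universe u

namespace Literature.NumberTheory.EllipticCurves

namespace TateModule

variable {A : Type u} [AddCommGroup A] {p : ℕ} [Fact p.Prime]

/-! ### Arithmetic: valuations under `p^M`-congruences; integral models of rational polynomials -/

omit [Fact p.Prime] in
/-- If `p^M ∣ x - y` with `y ≠ 0` and `M > v_p(y)`, then `x ≠ 0` and `v_p(x) = v_p(y)`. [folklore] -/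
theorem padicValInt_eq_of_pow_dvd_sub [hp : Fact p.Prime] {x y : ℤ} {M : ℕ} (hy : y ≠ 0)
    (hM : padicValInt p y < M) (h : (p : ℤ) ^ M ∣ x - y) :
    x ≠ 0 ∧ padicValInt p x = padicValInt p y := by
  set v := padicValInt p y with hv
  have hpv : (p : ℤ) ^ v ∣ y := (padicValInt_dvd_iff v y).mpr (Or.inr le_rfl)
  have hpvx : (p : ℤ) ^ v ∣ x := by
    have : (p : ℤ) ^ v ∣ x - y := (pow_dvd_pow _ hM.le).trans h
    simpa using this.add hpv
  have hnot : ¬ (p : ℤ) ^ (v + 1) ∣ y := by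
    intro hd
    rcases (padicValInt_dvd_iff (v + 1) y).mp hd with h0 | hle
    · exact hy h0
    · omega
  have hnotx : ¬ (p : ℤ) ^ (v + 1) ∣ x := by
    intro hd
    apply hnot
    have : (p : ℤ) ^ (v + 1) ∣ x - y := (pow_dvd_pow _ (by omega)).trans h
    have := hd.sub this
    simpa using this
  have hx : x ≠ 0 := by rintro rfl; exact hnotx (dvd_zero _)
  refine ⟨hx, le_antisymm ?_ ?_⟩
  · by_contra hlt
    push Not at hlt
    exact hnotx ((padicValInt_dvd_iff (v + 1) x).mpr (Or.inr (by omega)))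
  · rcases (padicValInt_dvd_iff v x).mp hpvx with h0 | hle
    · exact absurd h0 hx
    · exact hle

omit [Fact p.Prime] in
/-- **Clearing denominators**: a polynomial `H` in finitely many variables over `ℚ` has an integral
model `H'` with `H'(c) = D · H(c)` for all integer points `c`, for some integer `D ≠ 0`. [folklore] -/
theorem exists_int_model_mvPolynomial {σ : Type*} (H : MvPolynomial σ ℚ) :
    ∃ (D : ℤ) (H' : MvPolynomial σ ℤ), D ≠ 0 ∧ ∀ c : σ → ℤ,
      ((MvPolynomial.eval c H' : ℤ) : ℚ) = D * MvPolynomial.eval (fun k => (c k : ℚ)) H := by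
  induction H using MvPolynomial.induction_on with
  | C a =>
    refine ⟨a.den, MvPolynomial.C a.num, by exact_mod_cast a.den_ne_zero, fun c => ?_⟩
    rw [MvPolynomial.eval_C, MvPolynomial.eval_C, mul_comm]
    exact_mod_cast (Rat.mul_den_eq_num a).symm
  | add P Q hP hQ =>
    obtain ⟨D₁, P', hD₁, hP'⟩ := hP
    obtain ⟨D₂, Q', hD₂, hQ'⟩ := hQ
    refine ⟨D₁ * D₂, MvPolynomial.C D₂ * P' + MvPolynomial.C D₁ * Q', mul_ne_zero hD₁ hD₂, fun c => ?_⟩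
    rw [map_add, map_mul, map_mul, MvPolynomial.eval_C, MvPolynomial.eval_C, map_add]
    push_cast
    rw [hP', hQ']
    ring
  | mul_X P k hP =>
    obtain ⟨D, P', hD, hP'⟩ := hP
    refine ⟨D, P' * MvPolynomial.X k, hD, fun c => ?_⟩
    rw [map_mul, map_mul, MvPolynomial.eval_X, MvPolynomial.eval_X]
    push_cast
    rw [hP']
    ring

omit [Fact p.Prime] in
/-- Integral polynomials respect congruences: if `n ∣ c k - c' k` for all `k`, then
`n ∣ H(c) - H(c')`. [folklore] -/
theorem dvd_eval_sub_eval {σ : Type*} (H : MvPolynomial σ ℤ) {n : ℤ} {c c' : σ → ℤ}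
    (h : ∀ k, n ∣ c k - c' k) : n ∣ MvPolynomial.eval c H - MvPolynomial.eval c' H := by
  induction H using MvPolynomial.induction_on with
  | C a => simp
  | add P Q hP hQ =>
    have : MvPolynomial.eval c (P + Q) - MvPolynomial.eval c' (P + Q) =
        (MvPolynomial.eval c P - MvPolynomial.eval c' P) +
          (MvPolynomial.eval c Q - MvPolynomial.eval c' Q) := by
      rw [map_add, map_add]; ring
    rw [this]
    exact hP.add hQ
  | mul_X P k hP =>
    have : MvPolynomial.eval c (P * MvPolynomial.X k) - MvPolynomial.eval c' (P * MvPolynomial.X k) =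
        (MvPolynomial.eval c P - MvPolynomial.eval c' P) * c k +
          MvPolynomial.eval c' P * (c k - c' k) := by
      rw [map_mul, map_mul, MvPolynomial.eval_X, MvPolynomial.eval_X]; ring
    rw [this]
    exact (hP.mul_right _).add ((h k).mul_left _)

/-! ### `δ` is `p`-adically continuous in the constant term -/

omit [Fact p.Prime] in
/-- A monic polynomial of degree `e` written through its coefficient vector on `Fin e`
(Mathlib `Polynomial.Monic.as_sum`, reindexed). [folklore] -/
theorem monic_eq_X_pow_add_sum {F : ℤ[X]} (hF : F.Monic) :
    F = X ^ F.natDegree + ∑ k : Fin F.natDegree, C (F.coeff k) * X ^ (k : ℕ) := by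
  conv_lhs => rw [hF.as_sum]
  rw [Finset.sum_range (fun i => C (F.coeff i) * X ^ i)]

omit [Fact p.Prime] in
/-- Shifting the constant coefficient of the coefficient vector shifts the polynomial by a constant
(`e ≥ 1`). [folklore] -/
theorem sum_C_mul_X_pow_add_single {e : ℕ} (he : 0 < e) (v : Fin e → ℤ) (t : ℤ) :
    (∑ k : Fin e, C (v k + (Pi.single (⟨0, he⟩ : Fin e) t : Fin e → ℤ) k) * X ^ (k : ℕ) : ℤ[X]) =
      (∑ k : Fin e, C (v k) * X ^ (k : ℕ)) + C t := by
  have hsplit : ∀ k : Fin e, C (v k + (Pi.single (⟨0, he⟩ : Fin e) t : Fin e → ℤ) k) * X ^ (k : ℕ) =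
      C (v k) * X ^ (k : ℕ) + C ((Pi.single (⟨0, he⟩ : Fin e) t : Fin e → ℤ) k) * X ^ (k : ℕ) := by
    intro k
    rw [C_add, add_mul]
  rw [Finset.sum_congr rfl fun k _ => hsplit k, Finset.sum_add_distrib]
  congr 1
  rw [Finset.sum_eq_single (⟨0, he⟩ : Fin e)]
  · rw [Pi.single_eq_same]
    simp
  · intro k _ hk
    rw [Pi.single_eq_of_ne hk, C_0, zero_mul]
  · intro h
    exact absurd (Finset.mem_univ _) h

/-- **`δ` is `p`-adically continuous in the constant term.**  If `δ` is polynomial on the monic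
polynomials of each degree (`hpoly`), then for every monic `F` of positive degree with `δ F ≠ 0` there is
`M₀` such that for all `M ≥ M₀` and all `c ∈ ℤ`: `δ(F + c p^M) ≠ 0` and `v_p(δ(F + c p^M)) = v_p(δ F)`
(clear the denominators of `H_e` and reduce modulo `p^M`).
[cite: Milne1986AbelianVarieties, §12, proof of Prop. 12.9] -/
theorem padicValInt_delta_shift_eq {δ : ℤ[X] → ℤ}
    (hpoly : ∀ e : ℕ, ∃ H : MvPolynomial (Fin e) ℚ, ∀ c : Fin e → ℤ,
      (δ (X ^ e + ∑ k : Fin e, C (c k) * X ^ (k : ℕ)) : ℚ) = MvPolynomial.eval (fun k => (c k : ℚ)) H)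
    {F : ℤ[X]} (hF : F.Monic) (he : 0 < F.natDegree) (hδ : δ F ≠ 0) :
    ∃ M₀ : ℕ, ∀ M : ℕ, M₀ ≤ M → ∀ c : ℤ,
      δ (F + C (c * (p : ℤ) ^ M)) ≠ 0 ∧
        padicValInt p (δ (F + C (c * (p : ℤ) ^ M))) = padicValInt p (δ F) := by
  obtain ⟨H, hH⟩ := hpoly F.natDegree
  obtain ⟨D, H', hD, hH'⟩ := exists_int_model_mvPolynomial H
  set v : Fin F.natDegree → ℤ := fun k => F.coeff k with hv
  -- `D δ G = H'(coefficients of G)` for the monic polynomials `G` of degree `deg F`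
  have key : ∀ c : Fin F.natDegree → ℤ,
      D * δ (X ^ F.natDegree + ∑ k : Fin F.natDegree, C (c k) * X ^ (k : ℕ)) =
        MvPolynomial.eval c H' := by
    intro c
    have h1 := hH c
    have h2 := hH' c
    rw [← h1] at h2
    exact_mod_cast h2.symm
  have hFv : F = X ^ F.natDegree + ∑ k : Fin F.natDegree, C (v k) * X ^ (k : ℕ) :=
    monic_eq_X_pow_add_sum hF
  have hDδ : D * δ F ≠ 0 := mul_ne_zero hD hδ
  refine ⟨padicValInt p (D * δ F) + 1, fun M hM c => ?_⟩
  set v' : Fin F.natDegree → ℤ := fun k =>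
    v k + (Pi.single (⟨0, he⟩ : Fin F.natDegree) (c * (p : ℤ) ^ M) : Fin F.natDegree → ℤ) k with hv'
  have hF'v : F + C (c * (p : ℤ) ^ M) =
      X ^ F.natDegree + ∑ k : Fin F.natDegree, C (v' k) * X ^ (k : ℕ) := by
    rw [hv', sum_C_mul_X_pow_add_single he, ← add_assoc, ← hFv]
  -- `p^M ∣ D δ(F + c p^M) - D δ F`
  have e1 : D * δ (F + C (c * (p : ℤ) ^ M)) = MvPolynomial.eval v' H' := by
    rw [hF'v]; exact key v'
  have e2 : D * δ F = MvPolynomial.eval v H' := by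
    have h := key v
    rwa [← hFv] at h
  have hdvd : (p : ℤ) ^ M ∣ D * δ (F + C (c * (p : ℤ) ^ M)) - D * δ F := by
    rw [e1, e2]
    refine dvd_eval_sub_eval H' fun k => ?_
    rw [hv']
    dsimp only
    by_cases hk : k = ⟨0, he⟩
    · subst hk
      rw [Pi.single_eq_same, add_sub_cancel_left]
      exact Dvd.intro_left c rfl
    · rw [Pi.single_eq_of_ne hk, add_zero, sub_self]
      exact dvd_zero _
  obtain ⟨hne, hval⟩ := padicValInt_eq_of_pow_dvd_sub hDδ (by omega) hdvd
  have hne' : δ (F + C (c * (p : ℤ) ^ M)) ≠ 0 := fun h => hne (by rw [h, mul_zero])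
  refine ⟨hne', ?_⟩
  rw [padicValInt.mul hD hne', padicValInt.mul hD hδ] at hval
  omega

/-! ### The kernel count for all `F` from the count on a shift-dense class -/

/-- `F(φ)` and `(F + t)(φ)` agree on elements killed by `t`: `(F + C t)(φ) a = F(φ) a + t • a`.
[folklore] -/
theorem aeval_add_C_apply (φ : AddMonoid.End A) (F : ℤ[X]) (t : ℤ) (a : A) :
    (aeval φ (F + C t) : AddMonoid.End A) a = (aeval φ F : AddMonoid.End A) a + t • a := by
  rw [map_add, aeval_C, algebraMap_int_eq, eq_intCast]
  rfl

omit [Fact p.Prime] in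
/-- An element killed by `p^M` is killed by `c p^M`. [folklore] -/
theorem mul_pow_smul_eq_zero {a : A} {M : ℕ} (ha : (p ^ M : ℕ) • a = 0) (c : ℤ) :
    (c * (p : ℤ) ^ M) • a = 0 := by
  rw [mul_zsmul, show ((p : ℤ) ^ M) • a = (p ^ M : ℕ) • a by
    rw [← natCast_zsmul, Nat.cast_pow], ha, zsmul_zero]

omit [Fact p.Prime] in
/-- An element killed by `p^n` is killed by `p^m` for `m ≥ n`. [folklore] -/
theorem pow_smul_eq_zero_of_le {a : A} {n m : ℕ} (ha : (p ^ n : ℕ) • a = 0) (h : n ≤ m) :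
    (p ^ m : ℕ) • a = 0 := by
  obtain ⟨k, rfl⟩ := Nat.exists_eq_add_of_le h
  rw [pow_add, mul_comm, mul_nsmul', ha, nsmul_zero]

/-- **The kernel count for all monic `F` with `δ F ≠ 0` from the count on a shift-dense class `S`.**
Hypotheses: `δ` multiplicative and polynomial (`hmul`, `hpoly`, as in
`charpoly_map_eq_of_degreeFunction`); `S` is reached from every monic `F` and every `M` by a shift
`F + c p^M` (`hS`); and `#{a ∈ A[p^∞] | F(φ) a = 0} = p^{v_p(δ F)}` (finite) for monic `F ∈ S` with
`δ F ≠ 0` (`hker`).  Conclusion: the same count for every monic `F` with `δ F ≠ 0`.  Proof: for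
`F' = F + c p^M ∈ S` with `M` large, `v_p(δ F') = v_p(δ F) =: v` (`padicValInt_delta_shift_eq`), the
kernel of `F'(φ)` on `A[p^∞]` has `p^v` elements and is a subgroup, hence is killed by `p^v` and lies
in `A[p^M]` once `M ≥ v`, where `F'(φ) = F(φ)`; conversely every `a` in the kernel of `F(φ)` on `A[p^∞]`
lies in the kernel of a suitable `F'_a(φ)`, so is killed by `p^v` too; thus the two kernels coincide.
[cite: Milne1986AbelianVarieties, §12, Prop. 12.9 (proof) and §19, Thm. 19.1 (proof)] -/
theorem forall_ker_of_shift (φ : AddMonoid.End A)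
    {δ : ℤ[X] → ℤ} (hmul : ∀ F G : ℤ[X], δ (F * G) = δ F * δ G)
    (hpoly : ∀ e : ℕ, ∃ H : MvPolynomial (Fin e) ℚ, ∀ c : Fin e → ℤ,
      (δ (X ^ e + ∑ k : Fin e, C (c k) * X ^ (k : ℕ)) : ℚ) = MvPolynomial.eval (fun k => (c k : ℚ)) H)
    {S : ℤ[X] → Prop} (hS : ∀ F : ℤ[X], F.Monic → ∀ M : ℕ, ∃ c : ℤ, S (F + C (c * (p : ℤ) ^ M)))
    (hker : ∀ F : ℤ[X], F.Monic → S F → δ F ≠ 0 →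
      {a : A | (∃ n : ℕ, p ^ n • a = 0) ∧ (aeval φ F : AddMonoid.End A) a = 0}.Finite ∧
        Nat.card {a : A | (∃ n : ℕ, p ^ n • a = 0) ∧ (aeval φ F : AddMonoid.End A) a = 0} =
          p ^ padicValInt p (δ F)) :
    ∀ F : ℤ[X], F.Monic → δ F ≠ 0 →
      {a : A | (∃ n : ℕ, p ^ n • a = 0) ∧ (aeval φ F : AddMonoid.End A) a = 0}.Finite ∧
        Nat.card {a : A | (∃ n : ℕ, p ^ n • a = 0) ∧ (aeval φ F : AddMonoid.End A) a = 0} =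
          p ^ padicValInt p (δ F) := by
  intro F hF hδ
  -- degree `0`: `F = 1`, kernel `{0}`, `δ 1 = 1`
  rcases Nat.eq_zero_or_pos F.natDegree with he | he
  · have hF1 : F = 1 := by rw [← hF.natDegree_eq_zero]; exact he
    subst hF1
    have hδ1 : δ 1 = 1 := by
      have h := hmul 1 1
      rw [one_mul] at h
      have h' : 1 * δ 1 = δ 1 * δ 1 := by rw [one_mul]; exact h
      exact (mul_right_cancel₀ hδ h').symm
    have hset : {a : A | (∃ n : ℕ, p ^ n • a = 0) ∧ (aeval φ (1 : ℤ[X]) : AddMonoid.End A) a = 0} =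
        {0} := by
      ext a
      simp only [map_one, AddMonoid.End.one_apply, Set.mem_setOf_eq, Set.mem_singleton_iff]
      exact ⟨fun h => h.2, fun h => ⟨⟨0, by rw [h, smul_zero]⟩, h⟩⟩
    rw [hset, hδ1, padicValInt.one, pow_zero]
    exact ⟨Set.finite_singleton 0, by simp⟩
  -- positive degree: shift
  obtain ⟨M₀, hM₀⟩ := padicValInt_delta_shift_eq (p := p) hpoly hF he hδ
  set v := padicValInt p (δ F) with hv
  -- the kernels
  set KF := {a : A | (∃ n : ℕ, p ^ n • a = 0) ∧ (aeval φ F : AddMonoid.End A) a = 0} with hKF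
  have hmonic : ∀ (M : ℕ) (c : ℤ), (F + C (c * (p : ℤ) ^ M)).Monic := fun M c =>
    hF.add_of_left (lt_of_le_of_lt degree_C_le (by
      rw [degree_eq_natDegree hF.ne_zero]; exact_mod_cast he))
  -- for every `M ≥ M₀` a shifted polynomial in `S` and its kernel of order `p^v`, killed by `p^v`
  have hshift : ∀ M : ℕ, M₀ ≤ M → ∃ c : ℤ,
      {a : A | (∃ n : ℕ, p ^ n • a = 0) ∧
          (aeval φ (F + C (c * (p : ℤ) ^ M)) : AddMonoid.End A) a = 0}.Finite ∧
        Nat.card {a : A | (∃ n : ℕ, p ^ n • a = 0) ∧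
          (aeval φ (F + C (c * (p : ℤ) ^ M)) : AddMonoid.End A) a = 0} = p ^ v ∧
        ∀ a : A, ((∃ n : ℕ, p ^ n • a = 0) ∧
          (aeval φ (F + C (c * (p : ℤ) ^ M)) : AddMonoid.End A) a = 0) → (p ^ v : ℕ) • a = 0 := by
    intro M hM
    obtain ⟨c, hc⟩ := hS F hF M
    obtain ⟨hne, hval⟩ := hM₀ M hM c
    obtain ⟨hfin, hcard⟩ := hker _ (hmonic M c) hc hne
    rw [hval] at hcard
    refine ⟨c, hfin, hcard, fun a ha => ?_⟩
    -- the kernel is a subgroup of order `p^v` (Lagrange)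
    let Ksub : AddSubgroup A :=
      { carrier := {a : A | (∃ n : ℕ, p ^ n • a = 0) ∧
          (aeval φ (F + C (c * (p : ℤ) ^ M)) : AddMonoid.End A) a = 0}
        add_mem' := by
          rintro x y ⟨⟨n, hn⟩, hx⟩ ⟨⟨m, hm⟩, hy⟩
          refine ⟨⟨n + m, ?_⟩, by rw [map_add, hx, hy, add_zero]⟩
          rw [smul_add, pow_smul_eq_zero_of_le (p := p) hn (Nat.le_add_right n m),
            pow_smul_eq_zero_of_le (p := p) hm (Nat.le_add_left m n), add_zero]
        zero_mem' := ⟨⟨0, smul_zero _⟩, map_zero _⟩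
        neg_mem' := by
          rintro x ⟨⟨n, hn⟩, hx⟩
          exact ⟨⟨n, by rw [smul_neg, hn, neg_zero]⟩, by rw [map_neg, hx, neg_zero]⟩ }
    have hKcard : Nat.card Ksub = p ^ v := hcard
    haveI : Finite Ksub := hfin
    have h1 := card_nsmul_eq_zero' (x := (⟨a, ha⟩ : Ksub))
    rw [hKcard] at h1
    exact congrArg Subtype.val h1
  -- every element of the kernel of `F(φ)` on `A[p^∞]` is killed by `p^v`
  have hKF_tors : ∀ a ∈ KF, (p ^ v : ℕ) • a = 0 := by
    rintro a ⟨⟨n, hn⟩, ha⟩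
    obtain ⟨c, -, -, hkill⟩ := hshift (max M₀ n) (le_max_left _ _)
    refine hkill a ⟨⟨n, hn⟩, ?_⟩
    rw [aeval_add_C_apply, ha, zero_add]
    exact mul_pow_smul_eq_zero (pow_smul_eq_zero_of_le (p := p) hn (le_max_right _ _)) c
  -- compare with ONE shifted kernel at level `M = max M₀ v`
  obtain ⟨c, hfin, hcard, hkill⟩ := hshift (max M₀ v) (le_max_left _ _)
  have heq : KF = {a : A | (∃ n : ℕ, p ^ n • a = 0) ∧
      (aeval φ (F + C (c * (p : ℤ) ^ (max M₀ v))) : AddMonoid.End A) a = 0} := by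
    ext a
    constructor
    · intro ha
      refine ⟨ha.1, ?_⟩
      rw [aeval_add_C_apply, ha.2, zero_add]
      exact mul_pow_smul_eq_zero (pow_smul_eq_zero_of_le (p := p) (hKF_tors a ha) (le_max_right _ _)) c
    · intro ha
      refine ⟨ha.1, ?_⟩
      have h2 := ha.2
      rw [aeval_add_C_apply, mul_pow_smul_eq_zero
        (pow_smul_eq_zero_of_le (p := p) (hkill a ha) (le_max_right _ _)) c, add_zero] at h2
      exact h2
  rw [heq]
  exact ⟨hfin, hcard⟩

/-- **The shift class `ℓ ∤ F(0)`** (`ℓ` a prime different from `p`, e.g. the characteristic of the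
ground field): from every `F` and `M` one reaches it by `F + c p^M` with `c ∈ {1, 2}` — if `ℓ` divided
both `F(0) + p^M` and `F(0) + 2 p^M` it would divide `p^M`. [folklore] -/
theorem shift_coeff_zero_not_dvd {ℓ : ℕ} (hℓ : ℓ.Prime) (hℓp : ℓ ≠ p) (F : ℤ[X]) (M : ℕ) :
    ∃ c : ℤ, ¬ (ℓ : ℤ) ∣ (F + C (c * (p : ℤ) ^ M)).coeff 0 := by
  have hp : p.Prime := Fact.out
  by_contra h
  push Not at h
  have h1 := h 1
  have h2 := h 2
  rw [coeff_add, coeff_C_zero] at h1 h2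
  have h3 : (ℓ : ℤ) ∣ (p : ℤ) ^ M := by
    have := h2.sub h1
    have e : F.coeff 0 + 2 * (p : ℤ) ^ M - (F.coeff 0 + 1 * (p : ℤ) ^ M) = (p : ℤ) ^ M := by ring
    rwa [e] at this
  have h4 : (ℓ : ℤ) ∣ (p : ℤ) := Int.Prime.dvd_pow' hℓ h3
  have h5 : ℓ ∣ p := by exact_mod_cast h4
  exact hℓp ((Nat.prime_dvd_prime_iff_eq hℓ hp).mp h5)

/-! ### The conclusions of `TateModuleCharpolyOfDegree` under the weakened kernel hypothesis -/

variable {d : ℕ}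

/-- **`deg = det` with the kernel count only on a shift-dense class** (e.g. only for étale `F(φ)`):
`P` is the characteristic polynomial of `T_p(φ)` (`charpoly_map_eq_of_degreeFunction` and
`forall_ker_of_shift`). [cite: Milne1986AbelianVarieties, §12, Prop. 12.9] [cite: MumfordAV1970, §19, Thm. 4] -/
theorem charpoly_map_eq_of_degreeFunction_of_shift [Module.Free ℤ_[p] (TateModule A p)]
    [Module.Finite ℤ_[p] (TateModule A p)]
    (hcard : ∀ n, Nat.card (A[(p ^ n : ℕ)]) = p ^ (d * n)) (φ : AddMonoid.End A)
    {δ : ℤ[X] → ℤ} (hmul : ∀ F G : ℤ[X], δ (F * G) = δ F * δ G)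
    {P : ℤ[X]} (hP : P.Monic) (hPδ : ∀ m : ℤ, P.eval m = δ (X - C m))
    (hpoly : ∀ e : ℕ, ∃ H : MvPolynomial (Fin e) ℚ, ∀ c : Fin e → ℤ,
      (δ (X ^ e + ∑ k : Fin e, C (c k) * X ^ (k : ℕ)) : ℚ) = MvPolynomial.eval (fun k => (c k : ℚ)) H)
    {S : ℤ[X] → Prop} (hS : ∀ F : ℤ[X], F.Monic → ∀ M : ℕ, ∃ c : ℤ, S (F + C (c * (p : ℤ) ^ M)))
    (hker : ∀ F : ℤ[X], F.Monic → S F → δ F ≠ 0 →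
      {a : A | (∃ n : ℕ, p ^ n • a = 0) ∧ (aeval φ F : AddMonoid.End A) a = 0}.Finite ∧
        Nat.card {a : A | (∃ n : ℕ, p ^ n • a = 0) ∧ (aeval φ F : AddMonoid.End A) a = 0} =
          p ^ padicValInt p (δ F)) :
    (map p (φ : A →+ A)).charpoly = P.map (Int.castRingHom ℤ_[p]) :=
  charpoly_map_eq_of_degreeFunction hcard φ hmul hP hPδ hpoly (forall_ker_of_shift φ hmul hpoly hS hker)

/-- The rank is the degree of `P`, under the weakened kernel hypothesis.
[cite: Milne1986AbelianVarieties, §12, Prop. 12.9] -/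
theorem natDegree_eq_of_degreeFunction_of_shift
    (hcard : ∀ n, Nat.card (A[(p ^ n : ℕ)]) = p ^ (d * n)) (φ : AddMonoid.End A)
    {δ : ℤ[X] → ℤ} (hmul : ∀ F G : ℤ[X], δ (F * G) = δ F * δ G)
    {P : ℤ[X]} (hP : P.Monic) (hPδ : ∀ m : ℤ, P.eval m = δ (X - C m))
    (hpoly : ∀ e : ℕ, ∃ H : MvPolynomial (Fin e) ℚ, ∀ c : Fin e → ℤ,
      (δ (X ^ e + ∑ k : Fin e, C (c k) * X ^ (k : ℕ)) : ℚ) = MvPolynomial.eval (fun k => (c k : ℚ)) H)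
    {S : ℤ[X] → Prop} (hS : ∀ F : ℤ[X], F.Monic → ∀ M : ℕ, ∃ c : ℤ, S (F + C (c * (p : ℤ) ^ M)))
    (hker : ∀ F : ℤ[X], F.Monic → S F → δ F ≠ 0 →
      {a : A | (∃ n : ℕ, p ^ n • a = 0) ∧ (aeval φ F : AddMonoid.End A) a = 0}.Finite ∧
        Nat.card {a : A | (∃ n : ℕ, p ^ n • a = 0) ∧ (aeval φ F : AddMonoid.End A) a = 0} =
          p ^ padicValInt p (δ F)) :
    P.natDegree = d :=
  natDegree_eq_of_degreeFunction hcard φ hmul hP hPδ hpoly (forall_ker_of_shift φ hmul hpoly hS hker)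

/-- **`(-1)^{d(r+1)} δ(X^r - 1) = det(1 - T_p(φ)^r)`** under the weakened kernel hypothesis.
[cite: Milne1986AbelianVarieties, §12, Prop. 12.9, and §19, Thm. 19.1 (proof)] [cite: MumfordAV1970, §19 Thm. 4, §21] -/
theorem det_one_sub_map_pow_eq_of_degreeFunction_of_shift [Module.Free ℤ_[p] (TateModule A p)]
    [Module.Finite ℤ_[p] (TateModule A p)]
    (hcard : ∀ n, Nat.card (A[(p ^ n : ℕ)]) = p ^ (d * n)) (φ : AddMonoid.End A)
    {δ : ℤ[X] → ℤ} (hmul : ∀ F G : ℤ[X], δ (F * G) = δ F * δ G)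
    {P : ℤ[X]} (hP : P.Monic) (hPδ : ∀ m : ℤ, P.eval m = δ (X - C m))
    (hpoly : ∀ e : ℕ, ∃ H : MvPolynomial (Fin e) ℚ, ∀ c : Fin e → ℤ,
      (δ (X ^ e + ∑ k : Fin e, C (c k) * X ^ (k : ℕ)) : ℚ) = MvPolynomial.eval (fun k => (c k : ℚ)) H)
    {S : ℤ[X] → Prop} (hS : ∀ F : ℤ[X], F.Monic → ∀ M : ℕ, ∃ c : ℤ, S (F + C (c * (p : ℤ) ^ M)))
    (hker : ∀ F : ℤ[X], F.Monic → S F → δ F ≠ 0 →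
      {a : A | (∃ n : ℕ, p ^ n • a = 0) ∧ (aeval φ F : AddMonoid.End A) a = 0}.Finite ∧
        Nat.card {a : A | (∃ n : ℕ, p ^ n • a = 0) ∧ (aeval φ F : AddMonoid.End A) a = 0} =
          p ^ padicValInt p (δ F))
    {r : ℕ} (hr : 0 < r) :
    (((-1) ^ (d * (r + 1)) * δ (X ^ r - 1) : ℤ) : ℤ_[p]) = LinearMap.det (1 - map p (φ : A →+ A) ^ r) :=
  det_one_sub_map_pow_eq_of_degreeFunction hcard φ hmul hP hPδ hpoly
    (forall_ker_of_shift φ hmul hpoly hS hker) hr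

end TateModule

namespace RationalTateModule

variable {G : Type*} [Monoid G] {A : Type u} [AddCommGroup A] [DistribMulAction G A]
  {p : ℕ} [Fact p.Prime] {d : ℕ}

/-- **`det(1 - g^r | V_p A) = (-1)^{d(r+1)} δ(X^r - 1)`** for a monoid action, under the weakened
kernel hypothesis (only for `F` in a shift-dense class `S`, e.g. `F(g)` étale).
[cite: Milne1986AbelianVarieties, §12, Prop. 12.9; §19, Thm. 19.1 (proof)] [cite: MumfordAV1970, §19 Thm. 4, §21] -/
theorem det_one_sub_pow_eq_of_degreeFunction_of_shift [Module.Free ℤ_[p] (TateModule A p)]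
    [Module.Finite ℤ_[p] (TateModule A p)]
    (hcard : ∀ n, Nat.card (A[(p ^ n : ℕ)]) = p ^ (d * n)) (g : G)
    {δ : ℤ[X] → ℤ} (hmul : ∀ F G : ℤ[X], δ (F * G) = δ F * δ G)
    {P : ℤ[X]} (hP : P.Monic) (hPδ : ∀ m : ℤ, P.eval m = δ (X - C m))
    (hpoly : ∀ e : ℕ, ∃ H : MvPolynomial (Fin e) ℚ, ∀ c : Fin e → ℤ,
      (δ (X ^ e + ∑ k : Fin e, C (c k) * X ^ (k : ℕ)) : ℚ) = MvPolynomial.eval (fun k => (c k : ℚ)) H)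
    {S : ℤ[X] → Prop} (hS : ∀ F : ℤ[X], F.Monic → ∀ M : ℕ, ∃ c : ℤ, S (F + C (c * (p : ℤ) ^ M)))
    (hker : ∀ F : ℤ[X], F.Monic → S F → δ F ≠ 0 →
      {a : A | (∃ n : ℕ, p ^ n • a = 0) ∧
          (aeval (DistribMulAction.toAddMonoidEnd G A g) F : AddMonoid.End A) a = 0}.Finite ∧
        Nat.card {a : A | (∃ n : ℕ, p ^ n • a = 0) ∧
          (aeval (DistribMulAction.toAddMonoidEnd G A g) F : AddMonoid.End A) a = 0} =
            p ^ padicValInt p (δ F))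
    {r : ℕ} (hr : 0 < r) :
    LinearMap.det (1 - rationalTateRepresentation G A p g ^ r) =
      (((-1) ^ (d * (r + 1)) * δ (X ^ r - 1) : ℤ) : ℚ_[p]) :=
  det_one_sub_pow_eq_of_degreeFunction hcard g hmul hP hPδ hpoly
    (TateModule.forall_ker_of_shift _ hmul hpoly hS hker) hr

end RationalTateModule

end Literature.NumberTheory.EllipticCurves

end
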